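/-
Literature/AlgebraicGeometry/Pohlmann1968/DegenerateCMTypesAbelianCMFieldExponentTwiceSquarefree.lean — pub-hodgecm2 (COR-CM), KEPT Literature lane
lit-deligne-3 gen 65, file F65i.  THEOREMS ONLY (no `def`, no named fact, no `sorry`, no instance, no notation; D-0026 net debt 0).  HC_CM is NOT proved.
-/
import Literature.AlgebraicGeometry.Pohlmann1968.DegenerateCMTypesAbelianCMFieldExponentTwoOddPrimes
import Literature.NumberTheory.ComplexMultiplication.DegenerateCMTypesAbelianKernelsExponentTwiceSquarefree
import HarnessLib

/-!
# Degenerate CM types of ABELIAN CM fields with `g^{2m} = 1` on `Gal(K/ℚ)`, `m` ODD SQUAREFREE (any number of primes): the rank formula on `Gal(K/ℚ)`,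
# the nondegeneracy criterion, the Hodge conjecture for all powers off the lists, and the first three-prime cyclotomic level `ℚ(ζ₂₁₁)`

Topic `Literature/AlgebraicGeometry/Pohlmann1968` (namespace `Literature.AlgebraicGeometry.Pohlmann1968.ExponentTwiceSquarefree`); cell `pub-hodgecm2` (COR-CM),
KEPT Literature lane `lit-deligne-3` gen 65, file F65i — the FIELD side of the lane's squarefree-odd-part programme at the level of `Gal(K/ℚ)`: the group
theorem F65g (`CyclicCMType.AbelianKernels.typeRank_add_card_add_sum_totient_mul_card_eq`) transferred to abelian CM fields, the index-`2` class read on the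
imaginary quadratic subfields (Weil type), and the consequences for abelian varieties.  The two-prime case with the full subfield dictionary is the tree's
`ExponentTwoOddPrimes` (F65a); the dictionary for `|D| ≥ 3` («mixed differences of coset counts at `Gal(K/F)` ⟺ mixed differences of the restriction counts
over the CM subfield `F`») is left to the successor and the index-`2Π_D q` classes are stated here on the subgroups of `Gal(K/ℚ)`.  KERNEL ONLY: theorems; no
`def`, no named fact, no instance, no notation (D-0014 ∕ D-0026 net debt `0`).  HC_CM is NOT proved here or anywhere in the lane.

## Mathematics

`K` an abelian CM field with `g^{2m} = 1` on `G = Gal(K/ℚ)` (`m` odd squarefree), `Φ` a CM type, `S = {g : φ₀ ∘ g⁻¹ ∈ Φ}`, `ρ` = complex conjugation.  By F65g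
(Kubota's defect by kernels, every class decided):

  `Rank(Φ) + #B₂ + Σ_{∅ ≠ D ⊆ primeFactors(m)} φ(2Π_{q∈D} q)·#B_D = [K:ℚ]/2 + 1`      (**`cmTypeRank_add_card_add_sum_totient_mul_card_eq`**),

`B₂` = index-`2` subgroups `H ∌ ρ` splitting `S` evenly = imaginary quadratic subfields over which `Φ` is of Weil type ([Dodson1984] §3.1.1; tree
`card_filter_mem_eq_iff_balanced`), `B_D` = subgroups `H ∌ ρ` of index `2Π_D q` at which all `|D|`-th mixed differences
`Σ_{ε∈{0,1}^D} (−1)^{|ε|} #(S ∩ g·Π_{ε_q=1} x_q·H)` (`x_q^{q} ∈ H`) vanish ([Hazama2003CyclicCM] Lemma 4.6.1 mechanism; [LamLeung2000] Thm. 2.2).  Hence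
(**`isNondegenerate_iff`**) `Φ` is NONDEGENERATE iff it is of Weil type over no imaginary quadratic subfield and `B_D = ∅` for every nonempty `D`; and then
(Hazama–Pohlmann, tree `IsNondegenerate.hodgeClassSpan_pow_eq_divisorClassesSpan`) `B•(Aⁿ) ⊗ ℂ = D•(Aⁿ) ⊗ ℂ` and THE HODGE CONJECTURE holds for ALL POWERS of
EVERY abelian variety of type `(K; Φ)` (**`hodgeClassSpan_pow_eq_divisorClassesSpan_of_forall`**, **`hodgeConjectureFor_pow_of_forall`**) — unconditional.
§3 transfers to `ℚ(ζ_N)` with `u^{2m} = 1` on `(ℤ/N)ˣ` (**`hodgeConjectureFor_pow_of_forall_of_isCyclotomicExtension`**) and records the first level whose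
exponent carries three odd primes: `N = 211` (prime, `(ℤ/211)ˣ ≅ ℤ/210`, `210 = 2·3·5·7`; **`units_pow_twoHundredTen_twoHundredEleven`** by kernel decision,
**`hodgeConjectureFor_pow_of_forall_twoHundredEleven`**) — beyond every earlier file of the lane (exponents `2p, 4p, 2p², 4p², 2pq, 4pq`).

PRESEARCH (lane rule): «degenerate CM types of ℚ(ζ₂₁₁)» ∕ «rank of CM types abelian CM field squarefree exponent» — corpus hybrid + galaxy (earlier lane
queries, addenda 278–280): not in print beyond the cited ingredients; recorded as the lane's own elementary consequence of F65g and the tree.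

HONEST REGISTER.  Unconditional given the tree.  The index-`2Π_D q` conditions are on subgroups of `Gal(K/ℚ)` (not yet read on subfields for `|D| ≥ 3`);
the `2`-part of the exponent is exactly `2`; the cyclotomic statements carry the true instance hypotheses `[IsCMField L] [IsAbelianGalois ℚ L]` (supplied for
`ℚ(ζ_N)` by the tree's `cm_abelian_pow_eq_one_of_isCyclotomicExtension`).  Nothing is claimed about the Hodge classes of DEGENERATE types.  HC_CM is NOT proved
and not used.

## References

* [Kubota1965] T. Kubota, *On the field extension by complex multiplication*, Trans. AMS 118 (1965), §4 Lemma 2.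
* [Dodson1984] B. Dodson, *The structure of Galois groups of CM-fields*, Trans. AMS 283 (1984), §3.1.1 Theorem.
* [Hazama2003CyclicCM] F. Hazama, J. Math. Sci. Univ. Tokyo 10 (2003): Prop. 4.3, Lemma 4.6.1, Thm. 4.8.
* [LamLeung2000] T. Y. Lam, K. H. Leung, *On vanishing sums of roots of unity*, J. Algebra 224 (2000), Thm. 2.2.
* [Gordon1999HodgeAVSurvey] B. B. Gordon, *A survey of the Hodge conjecture for abelian varieties* (1999), Thm. 6.4, §9.3.
* [Deligne2000] P. Deligne, *The Hodge conjecture* (Clay, 2000), §1.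
* [Washington1997] L. C. Washington, *Introduction to Cyclotomic Fields*, 2nd ed., GTM 83 (1997), Ch. 2 Thm. 2.5.

## Provenance

Cell `pub-hodgecm2` (COR-CM), KEPT Literature lane `lit-deligne-3` gen 65 (claim ABELIAN-EXPONENT-2SQUAREFREE-FIELD; count-neutral, own lane), file F65i;
neighbours cited by name, nothing restated: `DegenerateCMTypesAbelianCMFieldExponentTwoOddPrimes` (F65a, imported for the cone and the index-`2` reading),
`DegenerateCMTypesAbelianKernelsExponentTwiceSquarefree` (F65g), `DegenerateCMTypesAbelianCMFieldExponentFourTimesPrime` (`cm_abelian_pow_eq_one_of_isCyclotomicExtension`).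
Theorems only; net Literature debt 0.
-/

noncomputable section

open scoped BigOperators NumberField IsMulCommutative Classical
open NumberField IntermediateField

namespace Literature.AlgebraicGeometry.Pohlmann1968

namespace ExponentTwiceSquarefree

open Literature.NumberTheory.ComplexMultiplication
open Literature.NumberTheory.ComplexMultiplication.CMNumbers
open Literature.AlgebraicGeometry.Motives (CMType)
open Literature.AlgebraicGeometry.Pohlmann1968.CyclicTwoOddPrimes (isCMTypeWith_galType cmTypeRank_eq_typeRank_galType)
open Literature.AlgebraicGeometry.Pohlmann1968.AbelianKernels
open Literature.AlgebraicGeometry.Pohlmann1968.ExponentFourTimesPrime (cm_abelian_pow_eq_one_of_isCyclotomicExtension)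

/-! ## §1 Abelian CM fields with `g^{2m} = 1` on `Gal(K/ℚ)`, `m` odd squarefree: the rank formula and the nondegeneracy criterion -/

section Field

variable {K : Type} [Field K] [NumberField K] [IsCMField K] [IsAbelianGalois ℚ K] {m : ℕ}

/-- **The defect on `Gal(K/ℚ)` for an abelian CM field of exponent `2m`, `m` odd squarefree** (`S = {g : σ_g ∈ Φ}`, `σ_g = φ₀ ∘ g⁻¹`, `ρ` = complex
conjugation): `Rank(Φ) + #B₂ + Σ_{∅ ≠ D ⊆ primes(m)} φ(2Π_D q)·#B_D = [K:ℚ]/2 + 1`, the lane's group-level F65g read on the subgroups of `Gal(K/ℚ)`.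
[cite: Kubota1965, §4 Lemma 2] [cite: Hazama2003CyclicCM, Prop. 4.3 and Thm. 4.8] [cite: Dodson1984, §3.1.1 Theorem] [cite: LamLeung2000, Thm. 2.2] -/
theorem cmTypeRank_add_card_add_sum_totient_mul_card_eq (hm : Squarefree m) (hodd : ¬ 2 ∣ m) (φ₀ : K →+* ℂ)
    (hexp : ∀ g : K ≃ₐ[ℚ] K, g ^ (2 * m) = 1) (Φ : CMType K) :
    cmTypeRank Φ +
      ((Finset.univ : Finset (Subgroup (K ≃ₐ[ℚ] K))).filter fun H =>
        (conjGal : K ≃ₐ[ℚ] K) ∉ H ∧ H.index = 2 ∧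
        ((Finset.univ.filter fun g : K ≃ₐ[ℚ] K => embOf φ₀ g ∈ Φ.1).filter fun s => s ∈ H).card =
          ((Finset.univ.filter fun g : K ≃ₐ[ℚ] K => embOf φ₀ g ∈ Φ.1).filter fun s => s ∉ H).card).card +
      ∑ D ∈ m.primeFactors.powerset.filter (fun D => D.Nonempty),
        (2 * ∏ q ∈ D, q).totient *
          ((Finset.univ : Finset (Subgroup (K ≃ₐ[ℚ] K))).filter fun H => (conjGal : K ≃ₐ[ℚ] K) ∉ H ∧ H.index = 2 * ∏ q ∈ D, q ∧
            ∀ (g : K ≃ₐ[ℚ] K) (x : D → (K ≃ₐ[ℚ] K)), (∀ q : D, x q ^ (q : ℕ) ∈ H) →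
              ∑ ε : D → Bool, (∏ q, (if ε q then (-1 : ℤ) else 1)) *
                (((Finset.univ.filter fun g : K ≃ₐ[ℚ] K => embOf φ₀ g ∈ Φ.1).filter
                  fun s => (g * ∏ q, (if ε q then x q else 1))⁻¹ * s ∈ H).card : ℤ) = 0).card =
      Module.finrank ℚ K / 2 + 1 := by
  rw [cmTypeRank_eq_typeRank_galType Φ φ₀, ← card_gal_eq_finrank φ₀]
  exact CyclicCMType.AbelianKernels.typeRank_add_card_add_sum_totient_mul_card_eq hm hodd
    (isCMTypeWith_galType (AbelianCMFieldExistence.apply_conjGal_eq φ₀) Φ) hexp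

/-- **NONDEGENERACY CRITERION IN EXPONENT `2m`, `m` ODD SQUAREFREE (on `Gal(K/ℚ)`).**  A CM type `Φ` of an abelian CM field `K` with `g^{2m} = 1` on
`Gal(K/ℚ)` is NONDEGENERATE iff (i) `Φ` is balanced over NO imaginary quadratic subfield (Weil type over none of them) and (ii) for every nonempty set
`D` of prime divisors of `m`, at NO subgroup `H ∌ ρ` of index `2Π_{q∈D} q` do the `|D|`-th mixed differences of the coset counts of `S` vanish — one
surviving character per admissible kernel. [cite: Kubota1965, §4 Lemma 2] [cite: Hazama2003CyclicCM, Prop. 4.3 and Thm. 4.8] [cite: Dodson1984, §3.1.1 Theorem] -/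
theorem isNondegenerate_iff (hm : Squarefree m) (hodd : ¬ 2 ∣ m) (φ₀ : K →+* ℂ) (hexp : ∀ g : K ≃ₐ[ℚ] K, g ^ (2 * m) = 1)
    (Φ : CMType K) :
    IsNondegenerate Φ ↔
      (∀ F : IntermediateField ℚ K, Module.finrank ℚ F = 2 → ¬ IsTotallyReal F →
        ¬ ∀ τ : F →+* ℂ, {φ : K →+* ℂ | φ.comp (algebraMap F K) = τ ∧ φ ∈ Φ.1}.ncard =
          {φ : K →+* ℂ | φ.comp (algebraMap F K) = τ ∧ φ ∉ Φ.1}.ncard) ∧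
      ∀ D ∈ m.primeFactors.powerset, D.Nonempty → ∀ H : Subgroup (K ≃ₐ[ℚ] K), (conjGal : K ≃ₐ[ℚ] K) ∉ H →
        H.index = 2 * ∏ q ∈ D, q →
        ¬ ∀ (g : K ≃ₐ[ℚ] K) (x : D → (K ≃ₐ[ℚ] K)), (∀ q : D, x q ^ (q : ℕ) ∈ H) →
          ∑ ε : D → Bool, (∏ q, (if ε q then (-1 : ℤ) else 1)) *
            (((Finset.univ.filter fun g : K ≃ₐ[ℚ] K => embOf φ₀ g ∈ Φ.1).filter
              fun s => (g * ∏ q, (if ε q then x q else 1))⁻¹ * s ∈ H).card : ℤ) = 0 := by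
  rw [Pohlmann1968.isNondegenerate_iff Φ, cmTypeRank_eq_typeRank_galType Φ φ₀, ← card_gal_eq_finrank φ₀,
    CyclicCMType.AbelianKernels.typeRank_eq_iff_of_exponent_two_mul_squarefree hm hodd
      (isCMTypeWith_galType (AbelianCMFieldExistence.apply_conjGal_eq φ₀) Φ) hexp]
  refine and_congr_left fun _ => ?_
  constructor
  · intro h F h2 hF hW
    have hρH : (conjGal : K ≃ₐ[ℚ] K) ∉ F.fixingSubgroup := (conjGal_not_mem_fixingSubgroup_iff F).2 hF
    exact h F.fixingSubgroup hρH (index_fixingSubgroup_eq_two F h2)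
      ((card_filter_mem_eq_iff_balanced φ₀ Φ F h2 hF).2 hW)
  · intro h H hρH hidx hsplit
    have h2 : Module.finrank ℚ (fixedField H) = 2 := by rw [← index_eq_finrank_fixedField, hidx]
    have hF : ¬ IsTotallyReal (fixedField H) := (conjGal_not_mem_iff_not_isTotallyReal_fixedField H).1 hρH
    refine h (fixedField H) h2 hF ((card_filter_mem_eq_iff_balanced φ₀ Φ (fixedField H) h2 hF).1 ?_)
    simpa only [fixingSubgroup_fixedField] using hsplit

end Field

/-! ## §2 Consequences for abelian varieties: `B•(Aⁿ) ⊗ ℂ = D•(Aⁿ) ⊗ ℂ` and the Hodge conjecture for all powers -/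

section Varieties

open Literature.AlgebraicGeometry.Motives (AbelianVariety)
open Literature.AlgebraicGeometry.HodgeTheory
open Literature.AlgebraicGeometry.ComplexMultiplication (IsCMTypeRealisation)
open Literature.AlgebraicGeometry.VanGeemen1994 (hodgeClassSpan)
open Literature.Barriers.HodgeConjecture (divisorClassesSpan)
open _root_.CategoryTheory _root_.CategoryTheory.Limits

variable {K : Type} [Field K] [NumberField K] [IsCMField K] [IsAbelianGalois ℚ K] {m : ℕ}
  {Φ : CMType K} {A : AbelianVariety ℂ} {ι : 𝓞 K →+* End A} {θ : K →+* Module.End ℂ (complexBetti A.X 1)}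

/-- `Bᵐ ⊗ ℂ = Dᵐ ⊗ ℂ` for all `m` on an abelian variety gives the Hodge conjecture for it (Lefschetz `(1,1)`, cup products, tree theorems).
[cite: Gordon1999HodgeAVSurvey, §9.3] -/
private theorem hodgeConjectureFor_of_forall_hodgeClassSpan_eq_ts (B : AbelianVariety ℂ)
    (h : ∀ n : ℕ, hodgeClassSpan B.dim B.X n = divisorClassesSpan B.X B.dim n) : HodgeConjectureFor B.dim B.X :=
  ⟨nonempty_hodgeModel_holds (Motives.AbelianVariety.isSmoothProjective_holds (A := B)),
    fun n _ hc hmm ↦ AbelianVariety.divisorClassesSpan_le_algebraicClasses B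
      (fun b hb hb' ↦ lefschetzOneOne_rational_holds (Motives.AbelianVariety.isSmoothProjective_holds (A := B)) b hb hb') n
      ((h n) ▸ Submodule.subset_span ⟨hc, hmm⟩)⟩

/-- **`B•(Aⁿ) ⊗ ℂ = D•(Aⁿ) ⊗ ℂ` FOR EVERY REALISATION OF A TYPE OFF THE LISTS** (abelian CM field with `g^{2m} = 1` on `Gal`, `m` odd squarefree): if
`Φ` is of Weil type over no imaginary quadratic subfield and, for every nonempty set `D` of prime divisors of `m`, at no subgroup `H ∌ ρ` of `Gal(K/ℚ)` of
index `2Π_{q∈D} q` do the mixed differences of the coset counts of `S = {g : φ₀ ∘ g⁻¹ ∈ Φ}` vanish, then `Φ` is nondegenerate, so all Hodge classes on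
all powers of every realisation are generated by divisor classes (Hazama's criterion ∕ Pohlmann; tree `IsNondegenerate.hodgeClassSpan_pow_eq_divisorClassesSpan`).
[cite: Kubota1965, §4 Lemma 2] [cite: Gordon1999HodgeAVSurvey, Thm. 6.4 and §9.3] [cite: Hazama2003CyclicCM, Prop. 4.3 and Thm. 4.8] -/
theorem hodgeClassSpan_pow_eq_divisorClassesSpan_of_forall (hm : Squarefree m) (hodd : ¬ 2 ∣ m) (φ₀ : K →+* ℂ)
    (hexp : ∀ g : K ≃ₐ[ℚ] K, g ^ (2 * m) = 1)
    (hW : ∀ F : IntermediateField ℚ K, Module.finrank ℚ F = 2 → ¬ IsTotallyReal F →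
        ¬ ∀ τ : F →+* ℂ, {φ : K →+* ℂ | φ.comp (algebraMap F K) = τ ∧ φ ∈ Φ.1}.ncard =
          {φ : K →+* ℂ | φ.comp (algebraMap F K) = τ ∧ φ ∉ Φ.1}.ncard)
    (hD : ∀ D ∈ m.primeFactors.powerset, D.Nonempty → ∀ H : Subgroup (K ≃ₐ[ℚ] K), (conjGal : K ≃ₐ[ℚ] K) ∉ H →
        H.index = 2 * ∏ q ∈ D, q →
        ¬ ∀ (g : K ≃ₐ[ℚ] K) (x : D → (K ≃ₐ[ℚ] K)), (∀ q : D, x q ^ (q : ℕ) ∈ H) →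
          ∑ ε : D → Bool, (∏ q, (if ε q then (-1 : ℤ) else 1)) *
            (((Finset.univ.filter fun g : K ≃ₐ[ℚ] K => embOf φ₀ g ∈ Φ.1).filter
              fun s => (g * ∏ q, (if ε q then x q else 1))⁻¹ * s ∈ H).card : ℤ) = 0)
    (hA : IsCMTypeRealisation Φ A ι θ) (n k : ℕ) :
    hodgeClassSpan (⨁ fun _ : Fin n => A).dim (⨁ fun _ : Fin n => A).X k =
      divisorClassesSpan (⨁ fun _ : Fin n => A).X (⨁ fun _ : Fin n => A).dim k :=
  ((isNondegenerate_iff hm hodd φ₀ hexp Φ).2 ⟨hW, hD⟩).hodgeClassSpan_pow_eq_divisorClassesSpan hA n k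

/-- **THE HODGE CONJECTURE FOR ALL POWERS OF EVERY REALISATION OF A TYPE OFF THE LISTS** (abelian CM field with `g^{2m} = 1` on `Gal`, `m` odd
squarefree; `Φ` of Weil type over no imaginary quadratic subfield and with non-vanishing mixed differences at every admissible kernel of index `> 2`) —
UNCONDITIONAL, any realisation. [cite: Gordon1999HodgeAVSurvey, Thm. 6.4 and §9.3] [cite: Kubota1965, §4 Lemma 2] [cite: Deligne2000, §1] -/
theorem hodgeConjectureFor_pow_of_forall (hm : Squarefree m) (hodd : ¬ 2 ∣ m) (φ₀ : K →+* ℂ) (hexp : ∀ g : K ≃ₐ[ℚ] K, g ^ (2 * m) = 1)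
    (hW : ∀ F : IntermediateField ℚ K, Module.finrank ℚ F = 2 → ¬ IsTotallyReal F →
        ¬ ∀ τ : F →+* ℂ, {φ : K →+* ℂ | φ.comp (algebraMap F K) = τ ∧ φ ∈ Φ.1}.ncard =
          {φ : K →+* ℂ | φ.comp (algebraMap F K) = τ ∧ φ ∉ Φ.1}.ncard)
    (hD : ∀ D ∈ m.primeFactors.powerset, D.Nonempty → ∀ H : Subgroup (K ≃ₐ[ℚ] K), (conjGal : K ≃ₐ[ℚ] K) ∉ H →
        H.index = 2 * ∏ q ∈ D, q →
        ¬ ∀ (g : K ≃ₐ[ℚ] K) (x : D → (K ≃ₐ[ℚ] K)), (∀ q : D, x q ^ (q : ℕ) ∈ H) →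
          ∑ ε : D → Bool, (∏ q, (if ε q then (-1 : ℤ) else 1)) *
            (((Finset.univ.filter fun g : K ≃ₐ[ℚ] K => embOf φ₀ g ∈ Φ.1).filter
              fun s => (g * ∏ q, (if ε q then x q else 1))⁻¹ * s ∈ H).card : ℤ) = 0)
    (hA : IsCMTypeRealisation Φ A ι θ) (n : ℕ) :
    HodgeConjectureFor (⨁ fun _ : Fin n => A).dim (⨁ fun _ : Fin n => A).X :=
  hodgeConjectureFor_of_forall_hodgeClassSpan_eq_ts _
    fun k ↦ hodgeClassSpan_pow_eq_divisorClassesSpan_of_forall hm hodd φ₀ hexp hW hD hA n k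

end Varieties

/-! ## §3 The cyclotomic fields `ℚ(ζ_N)` with `u^{2m} = 1` on `(ℤ/N)ˣ` (`m` odd squarefree); the first three-prime level `ℚ(ζ₂₁₁)` -/

section Cyclotomic

open Literature.AlgebraicGeometry.Motives (AbelianVariety)
open Literature.AlgebraicGeometry.HodgeTheory
open Literature.AlgebraicGeometry.ComplexMultiplication (IsCMTypeRealisation)
open Literature.AlgebraicGeometry.VanGeemen1994 (hodgeClassSpan)
open Literature.Barriers.HodgeConjecture (divisorClassesSpan)
open _root_.CategoryTheory _root_.CategoryTheory.Limits
open Polynomial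

variable {N m : ℕ} {L : Type} [Field L] [NumberField L]
  {Φ : CMType L} {A : AbelianVariety ℂ} {ι : 𝓞 L →+* End A} {θ : L →+* Module.End ℂ (complexBetti A.X 1)}

/-- **The Hodge conjecture for all powers of every abelian variety with CM by `ℚ(ζ_N)`, `(ℤ/N)ˣ` of exponent dividing `2m` (`m` odd squarefree), whose
type is off the lists** (as in `hodgeConjectureFor_pow_of_forall`).  The statement speaks of complex conjugation and of products in `Gal(L/ℚ)`, so it
carries the (true) instance hypotheses `[IsCMField L] [IsAbelianGalois ℚ L]`; for `L = ℚ(ζ_N)`, `N > 2`, both are supplied by the tree's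
`ExponentFourTimesPrime.cm_abelian_pow_eq_one_of_isCyclotomicExtension` (`haveI := (…).1; haveI := (…).2.1`). [cite: Gordon1999HodgeAVSurvey, Thm. 6.4 and §9.3]
[cite: Washington1997, Ch. 2 Thm. 2.5] -/
theorem hodgeConjectureFor_pow_of_forall_of_isCyclotomicExtension [NeZero N] [IsCyclotomicExtension {N} ℚ L] [IsCMField L] [IsAbelianGalois ℚ L]
    (h2N : 2 < N) (hm : Squarefree m) (hodd : ¬ 2 ∣ m) (hN : ∀ u : (ZMod N)ˣ, u ^ (2 * m) = 1) (φ₀ : L →+* ℂ)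
    (hW : ∀ F : IntermediateField ℚ L, Module.finrank ℚ F = 2 → ¬ IsTotallyReal F →
        ¬ ∀ τ : F →+* ℂ, {φ : L →+* ℂ | φ.comp (algebraMap F L) = τ ∧ φ ∈ Φ.1}.ncard =
          {φ : L →+* ℂ | φ.comp (algebraMap F L) = τ ∧ φ ∉ Φ.1}.ncard)
    (hD : ∀ D ∈ m.primeFactors.powerset, D.Nonempty → ∀ H : Subgroup (L ≃ₐ[ℚ] L), (conjGal : L ≃ₐ[ℚ] L) ∉ H →
        H.index = 2 * ∏ q ∈ D, q →
        ¬ ∀ (g : L ≃ₐ[ℚ] L) (x : D → (L ≃ₐ[ℚ] L)), (∀ q : D, x q ^ (q : ℕ) ∈ H) →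
          ∑ ε : D → Bool, (∏ q, (if ε q then (-1 : ℤ) else 1)) *
            (((Finset.univ.filter fun g : L ≃ₐ[ℚ] L => embOf φ₀ g ∈ Φ.1).filter
              fun s => (g * ∏ q, (if ε q then x q else 1))⁻¹ * s ∈ H).card : ℤ) = 0)
    (hA : IsCMTypeRealisation Φ A ι θ) (n : ℕ) :
    HodgeConjectureFor (⨁ fun _ : Fin n => A).dim (⨁ fun _ : Fin n => A).X :=
  hodgeConjectureFor_pow_of_forall hm hodd φ₀ (cm_abelian_pow_eq_one_of_isCyclotomicExtension h2N hN L).2.2.1 hW hD hA n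

/-! ### The level `211`: `(ℤ/211)ˣ ≅ ℤ/210`, exponent `210 = 2·3·5·7` — the first cyclotomic field whose exponent carries THREE odd primes -/

/-- `u²¹⁰ = 1` for every unit of `ℤ/211` (`211` prime, `(ℤ/211)ˣ ≅ ℤ/210` cyclic; kernel decision on residues). [cite: Washington1997, Ch. 2 Thm. 2.5] -/
theorem units_pow_twoHundredTen_twoHundredEleven (u : (ZMod 211)ˣ) : u ^ (2 * 105) = 1 := by
  have h : ∀ a : ZMod 211, Nat.Coprime a.val 211 → a ^ 210 = 1 := by decide +kernel
  exact Units.ext (by rw [Units.val_pow_eq_pow_val, h _ (ZMod.val_coe_unit_coprime u), Units.val_one])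

/-- `105 = 3·5·7` is squarefree. [folklore] -/
private theorem squarefree_oneHundredFive_ts : Squarefree (105 : ℕ) := by
  rw [show (105 : ℕ) = 3 * (5 * 7) by norm_num, Nat.squarefree_mul_iff, Nat.squarefree_mul_iff]
  exact ⟨by norm_num, Nat.prime_three.prime.squarefree, by norm_num, Nat.prime_five.prime.squarefree, (by norm_num : Nat.Prime 7).prime.squarefree⟩

/-- **`ℚ(ζ₂₁₁)`: THE HODGE CONJECTURE FOR ALL POWERS of every abelian variety with complex multiplication by `ℚ(ζ₂₁₁)` (CM `105`-folds) whose type is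
of Weil type over none of the imaginary quadratic subfields and whose coset counts have non-vanishing mixed differences at every subgroup `H ∌ ρ` of
`Gal(ℚ(ζ₂₁₁)/ℚ) ≅ ℤ/210` of index `2d`, `1 < d | 105`** — UNCONDITIONAL.  (`primeFactors 105 = {3, 5, 7}`; the seven nonempty `D` give the indices
`6, 10, 14, 30, 42, 70, 210`; the instance hypotheses `[IsCMField L] [IsAbelianGalois ℚ L]` hold for `ℚ(ζ₂₁₁)`, see
`hodgeConjectureFor_pow_of_forall_of_isCyclotomicExtension`.) [cite: Gordon1999HodgeAVSurvey, Thm. 6.4 and §9.3] [cite: Kubota1965, §4 Lemma 2] -/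
theorem hodgeConjectureFor_pow_of_forall_twoHundredEleven [IsCyclotomicExtension {211} ℚ L] [IsCMField L] [IsAbelianGalois ℚ L] (φ₀ : L →+* ℂ)
    (hW : ∀ F : IntermediateField ℚ L, Module.finrank ℚ F = 2 → ¬ IsTotallyReal F →
        ¬ ∀ τ : F →+* ℂ, {φ : L →+* ℂ | φ.comp (algebraMap F L) = τ ∧ φ ∈ Φ.1}.ncard =
          {φ : L →+* ℂ | φ.comp (algebraMap F L) = τ ∧ φ ∉ Φ.1}.ncard)
    (hD : ∀ D ∈ (105 : ℕ).primeFactors.powerset, D.Nonempty → ∀ H : Subgroup (L ≃ₐ[ℚ] L), (conjGal : L ≃ₐ[ℚ] L) ∉ H →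
        H.index = 2 * ∏ q ∈ D, q →
        ¬ ∀ (g : L ≃ₐ[ℚ] L) (x : D → (L ≃ₐ[ℚ] L)), (∀ q : D, x q ^ (q : ℕ) ∈ H) →
          ∑ ε : D → Bool, (∏ q, (if ε q then (-1 : ℤ) else 1)) *
            (((Finset.univ.filter fun g : L ≃ₐ[ℚ] L => embOf φ₀ g ∈ Φ.1).filter
              fun s => (g * ∏ q, (if ε q then x q else 1))⁻¹ * s ∈ H).card : ℤ) = 0)
    (hA : IsCMTypeRealisation Φ A ι θ) (n : ℕ) :
    HodgeConjectureFor (⨁ fun _ : Fin n => A).dim (⨁ fun _ : Fin n => A).X :=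
  haveI : NeZero (211 : ℕ) := ⟨by norm_num⟩
  hodgeConjectureFor_pow_of_forall_of_isCyclotomicExtension (N := 211) (by norm_num) squarefree_oneHundredFive_ts (by norm_num)
    units_pow_twoHundredTen_twoHundredEleven φ₀ hW hD hA n

end Cyclotomic

end ExponentTwiceSquarefree

end Literature.AlgebraicGeometry.Pohlmann1968

end
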